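import Summits.BirchSwinnertonDyer.BirchSwinnertonDyer.Theorems.GenusKolyvaginAtTwoGenusPrimitiveSupplyAtTwoHeegnerNonTorsion
import Summits.BirchSwinnertonDyer.BirchSwinnertonDyer.Theorems.GenusKolyvaginAtTwoGenusPrimitiveSupplyAtTwoTwinConverse
import Summits.BirchSwinnertonDyer.BirchSwinnertonDyer.Theorems.GenusKolyvaginAtTwoGenusPrimitiveSupplyAtTwoTwinSupply
import Summits.BirchSwinnertonDyer.BirchSwinnertonDyer.Theorems.GenusKolyvaginAtTwoGenusPrimitiveSupplyAtTwoTwinSupplyPrint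
import Summits.BirchSwinnertonDyer.BirchSwinnertonDyer.Theorems.GenusKolyvaginAtTwoGenusPrimitiveSupplyAtTwoHeegnerNonTorsionOfGZ
import Summits.BirchSwinnertonDyer.BirchSwinnertonDyer.Theorems.GenusKolyvaginAtTwoGenusPrimitiveSupplyAtTwoMultiGenusField
import Literature.NumberTheory.EllipticCurves.KolyvaginShaStructureIndexFormProofs
import Literature.NumberTheory.EllipticCurves.HeegnerPointsOfConductorOneRationalityProofs
import Literature.NumberTheory.EllipticCurves.HeegnerPointsOfConductorOneData
import Literature.NumberTheory.EllipticCurves.LFunctionSmulProofs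
import Literature.NumberTheory.QuadraticFields.HeegnerCondition

/-!
# Route `GenusKolyvaginAtTwo`, crux `GenusPrimitiveSupplyAtTwo` (stmt-BirchSwinnertonDyer-22136), line `genus-supply`:
# THE CRUX BY NAME FROM ITS THREE OPEN KERNELS, modulo published facts

Lead prover seat bsd-line-gk2-p1 (g2). HONEST FRAMING: the crux stays OPEN and BSD is not proved by any of this. This file is
the line's skeleton `Cruxes/GenusPrimitiveSupplyAtTwo/Lines/genus_supply.lean` (v4) with each registered stub replaced by its
landed reduction, so that the tree carries ONE sorry-free, by-name, CONDITIONAL closer whose hypotheses are exactly: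
* PUBLISHED: `exists_isNewformOf` (Modularity, BCDT 2001), `p_parity · 2` (Dokchitser–Dokchitser 2010 Thm. 1.4),
  `hasEntireLFunction_rat`, `gross_zagier` (Gross–Zagier 1986 Thm. I.6.3) — named facts of the tree;
* (CONV₂) the rank-one `2`-converse for non-CM curves (= crux 19220 of route `TwoAdicConverse`, widened off its reduction
  clause) — OPEN;
* (SUPPLY) some Kolyvagin-(H2)-admissible Heegner twist of a habitat curve is `2`-Selmer-minimal (Mazur–Rubin-type) — not in
  print for this local class;
* (U) on the habitat, some multi-genus Heegner trace `Tr_{K[n]/K(√ℓ₁*,…,√ℓ_r*)} y(n)` (`n` square-free of Kolyvagin primes at `2`)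
  is not `2`-divisible in `E(K[n])` — Birch's lemma at `2` for full-`2`-image curves ∕ Kolyvagin's conjecture mod `2` — OPEN.
Stub A = SUPPLY + CONV₂ (`stub_minimalTwinSupplyAtTwo_of_twoConverse`, p590220); stub B = GZ + entire `L`
(`stub_heegnerNonTorsionAtTwo_of_published`, p580851); stub C = U (`exists_derivedPoint_not_two_dvd_of_multiGenusTrace`,
p591643); glue (orientation, conductor-`1` datum, `M₀`, non-CM and analytic rank of the twin) as in the skeleton.
Helper for the crux item (`--supports stmt-BirchSwinnertonDyer-22136`, helper mode; conditional-result). No summit and no leaf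
is proved by this file; BSD is not proved by any of this.
-/

set_option linter.dupNamespace false -- tree convention: `Summit.BirchSwinnertonDyer.BirchSwinnertonDyer.Theorems` (summit = sub-problem)

noncomputable section

open scoped Classical

namespace Summit.BirchSwinnertonDyer.BirchSwinnertonDyer.Theorems.GenusKoly

open Finset NumberField WeierstrassCurve Literature.NumberTheory.EllipticCurves
  Literature.NumberTheory.EllipticCurves.ModularForms

/-- **McCallum's `M₀ = ord₂(y_K)` exists** (McCallum 1991 §5, proof of Lemma 5.1): a point of infinite order of `E(K[1])` has an
exact `2`-divisibility exponent (`K[1]` is a number field, `E(K[1])` is finitely generated).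
[cite: McCallumLMS1991, §5 Lemma 5.1 proof (p. 303)] -/
theorem exists_exactTwoDivisibility_of_not_isOfFinAddOrder (W : WeierstrassCurve ℚ) [W.IsElliptic] {K : Type} [Field K]
    [NumberField K] (hK : IsImaginaryQuadratic K) {N : ℕ} [NeZero N] (Dt : ModularParametrizationData W N) (β : ℤ)
    (ι : K →+* ℂ) (d₁ : KolyvaginHeegnerData Dt β ι 1) (hy : ¬ IsOfFinAddOrder d₁.derivedPoint) :
    ∃ M₀ : ℕ, (∃ Q : (W.baseChange (ringClassField K ι 1)).toAffine.Point, ((2 ^ M₀ : ℕ) : ℤ) • Q = d₁.derivedPoint) ∧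
      ¬ ∃ Q : (W.baseChange (ringClassField K ι 1)).toAffine.Point, ((2 ^ (M₀ + 1) : ℕ) : ℤ) • Q = d₁.derivedPoint := by
  haveI : NumberField (ringClassField K ι 1) := numberField_ringClassField hK ι one_ne_zero
  haveI : (W.baseChange (ringClassField K ι 1)).IsElliptic := by rw [baseChange]; infer_instance
  haveI : Module.Finite ℤ (W.baseChange (ringClassField K ι 1)).toAffine.Point := by
    convert (W.baseChange (ringClassField K ι 1)).module_finite_point_holds
  exact exists_pow_smul_eq_and_not_of_not_isOfFinAddOrder Nat.prime_two hy

/-- **THE CRUX `GenusPrimitiveSupplyAtTwo` BY NAME FROM ITS THREE OPEN KERNELS, modulo published facts.** Modularity ∧ `2`-parity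
∧ entire `L`-functions ∧ Gross–Zagier ∧ (CONV₂) ∧ (SUPPLY) ∧ (U) ⟹ `Theses.GenusKolyvaginAtTwo.GenusPrimitiveSupplyAtTwo`. The
three non-published hypotheses are spelled out in binders: (CONV₂) `∀ V non-CM globally minimal, corank_{ℤ₂} Sel_{2^∞}(V/ℚ) = 1 →
r_an(V) = 1`; (SUPPLY) in the frame of stub A without its analytic clause; (U) in the frame of stub C with the multi-genus trace
in place of `P(n)`. CONDITIONAL; the crux is OPEN exactly at (CONV₂) ∧ (SUPPLY) ∧ (U). BSD is not proved by any of this.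
[cite: GrossLMS1991, §3 (3.5), Prop. 3.7 (1), §4 (4.1)] [cite: GrossZagier1986, Thm. I.6.3] [cite: DokchitserDokchitserAnnals2010, Thm. 1.4]
[cite: McCallumLMS1991, §5 Lemma 5.1] -/
theorem genusPrimitiveSupplyAtTwo_of_kernels (hmod : exists_isNewformOf)
    (hpar : ∀ V : WeierstrassCurve ℚ, p_parity V 2) (hE : hasEntireLFunction_rat)
    (hGZ : ∀ (W : WeierstrassCurve ℚ) [NeZero (W.conductorNorm ℤ)] (K : Type) [Field K] [NumberField K],
      gross_zagier (W.conductorNorm ℤ) W K)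
    (hconv : ∀ (V : WeierstrassCurve ℚ) [V.IsElliptic] [V.IsGloballyMinimal],
      ¬ V.HasCM → V.selmerCorank 2 = 1 → V.analyticRank = 1)
    (hsupply : ∀ (W : WeierstrassCurve ℚ) [W.IsElliptic] [W.IsGloballyMinimal] [NeZero (W.conductorNorm ℤ)],
      ¬ W.HasCM → W.analyticRank = 0 → (∀ n : ℕ, 0 < n → W.HasSurjectiveModNGaloisRep ((2 : ℤ) ^ n)) →
      ∃ (K : Type) (_ : Field K) (_ : NumberField K),
        IsImaginaryQuadratic K ∧ Odd (NumberField.discr K) ∧ NumberField.discr K ≠ -3 ∧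
        SatisfiesHeegnerHypothesis (W.conductorNorm ℤ) K ∧
        ¬ IsSquare ((NumberField.discr K : ℚ) * -|W.Δ|) ∧ ¬ IsSquare ((NumberField.discr K : ℚ) * (-(2 * |W.Δ|))) ∧
        ∃ (Wd : WeierstrassCurve ℚ) (_ : Wd.IsElliptic) (_ : Wd.IsGloballyMinimal),
          (∃ C : WeierstrassCurve.VariableChange ℚ, C • W.quadraticTwist (NumberField.discr K : ℚ) = Wd) ∧
          Nat.card (Wd.selmerGroup 2) = 2)
    (hU : ∀ (W : WeierstrassCurve ℚ) [W.IsElliptic] [W.IsGloballyMinimal] [NeZero (W.conductorNorm ℤ)],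
      ¬ W.HasCM → W.analyticRank = 0 → (∀ n : ℕ, 0 < n → W.HasSurjectiveModNGaloisRep ((2 : ℤ) ^ n)) →
      Odd W.tamagawaProduct →
      ∀ (K : Type) [Field K] [NumberField K],
      IsImaginaryQuadratic K → Odd (NumberField.discr K) → NumberField.discr K ≠ -3 →
      SatisfiesHeegnerHypothesis (W.conductorNorm ℤ) K →
      ¬ IsSquare ((NumberField.discr K : ℚ) * -|W.Δ|) → ¬ IsSquare ((NumberField.discr K : ℚ) * (-(2 * |W.Δ|))) →
      ∀ (Dt : ModularParametrizationData W (W.conductorNorm ℤ)),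
      (∀ z ∈ Dt.L.lattice, ∃ w ∈ periodLattice Dt.f, z = (Dt.c : ℂ) * w) → Odd Dt.c →
      ∀ (β : ℤ) (ι : K →+* ℂ) (d₁ : KolyvaginHeegnerData Dt β ι 1), ¬ IsOfFinAddOrder d₁.derivedPoint →
      ∀ (Wd : WeierstrassCurve ℚ) [Wd.IsElliptic] [Wd.IsGloballyMinimal],
      (∃ C : WeierstrassCurve.VariableChange ℚ, C • W.quadraticTwist (NumberField.discr K : ℚ) = Wd) →
      Wd.analyticRank = 1 → Nat.card (Wd.selmerGroup 2) = 2 →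
      ∃ (n : ℕ) (d : KolyvaginHeegnerData Dt β ι n) (θ : ℕ → ringClassField K ι n)
        (T : Finset (ringClassField K ι n ≃ₐ[ℚ] ringClassField K ι n)), Squarefree n ∧
        (∀ ℓ ∈ n.primeFactors, Zhang2014.IsKolyvaginPrime (W.conductorNorm ℤ) W K 2 ℓ) ∧
        (∀ ℓ ∈ n.primeFactors, θ ℓ ^ 2 = algebraMap ℚ (ringClassField K ι n) ((-1 : ℚ) ^ (ℓ / 2) * ℓ)) ∧
        (∀ g, g ∈ T ↔ g ∈ ringClassGal ι n ∧ ∀ ℓ ∈ n.primeFactors, g (θ ℓ) = θ ℓ) ∧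
        ¬ ∃ Q : (W.baseChange (ringClassField K ι n)).toAffine.Point, (2 : ℤ) • Q =
          ∑ g ∈ T, pointGalHom W (ringClassField K ι n) g d.y) :
    Summit.BirchSwinnertonDyer.BirchSwinnertonDyer.Theses.GenusKolyvaginAtTwo.GenusPrimitiveSupplyAtTwo := by
  intro W _ _ _ hcm hr0 hρ hT hopt
  -- A = SUPPLY + CONV₂
  obtain ⟨K, iF, iN, hIQ, hodd, h3, hHe, hsq1, hsq2, Wd, iE, iM, hWd, hrd, hSel⟩ :=
    stub_minimalTwinSupplyAtTwo_of_twoConverse hmod hpar hconv hsupply W hcm hr0 hρ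
  obtain ⟨Dt, hoptDt, hc⟩ := hopt
  -- glue: orientation, embedding, conductor-`1` datum
  obtain ⟨β, hβ⟩ : ∃ β : ℤ, (4 * (W.conductorNorm ℤ : ℕ) : ℤ) ∣ β ^ 2 - NumberField.discr K :=
    Literature.NumberTheory.QuadraticFields.Quadratic.exists_dvd_sq_sub_discr_of_ncard_primesOver hIQ.1 (NeZero.ne _) hHe
  obtain ⟨ι⟩ : Nonempty (K →+* ℂ) := inferInstance
  obtain ⟨d₁⟩ := exists_kolyvaginHeegnerData_one
    (phi_heegnerTau_mem_singularModuliField_holds (W.conductorNorm ℤ) W K) hIQ Dt β ι hβ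
  -- the twin: non-CM, analytic rank of the twist read off the minimal model
  have hd : (NumberField.discr K : ℚ) ≠ 0 := by exact_mod_cast NumberField.discr_ne_zero K
  haveI := W.isElliptic_quadraticTwist hd
  have hcmd : ¬ Wd.HasCM := twin_not_hasCM W hcm hd Wd hWd
  have hrtw : (W.quadraticTwist (NumberField.discr K : ℚ)).analyticRank = 1 := by
    obtain ⟨C, hC⟩ := hWd
    rw [← analyticRank_smul (W.quadraticTwist (NumberField.discr K : ℚ)) C, hC]
    exact hrd
  -- B = Gross–Zagier + entire `L`
  have hy : ¬ IsOfFinAddOrder d₁.derivedPoint :=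
    stub_heegnerNonTorsionAtTwo_of_published hE hGZ W K hIQ hHe hr0 hrtw Dt β ι d₁
  obtain ⟨M₀, hdiv, hndiv⟩ := exists_exactTwoDivisibility_of_not_isOfFinAddOrder W hIQ Dt β ι d₁ hy
  -- C = U through the intrinsic dictionary
  obtain ⟨n, d, hn, hKoly, hPn⟩ := exists_derivedPoint_not_two_dvd_of_multiGenusTrace hIQ hodd h3 hHe
    (hU W hcm hr0 hρ hT K hIQ hodd h3 hHe hsq1 hsq2 Dt hoptDt hc β ι d₁ hy Wd hWd hrd hSel)
  exact ⟨K, iF, iN, hIQ, hodd, h3, hHe, hsq1, hsq2, Dt, β, ι, d₁, hoptDt, hc, hy, M₀, hdiv, hndiv, n, d, hn, hKoly, hPn,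
    Wd, iE, iM, hWd, hcmd, hrd, hSel⟩

open scoped AddSubgroup
/-! ### §2 (APPEND 1, same seat) With the siblings' discharges: SUPPLY from Mazur–Rubin lowering (gk2-p5), B from Gross–Zagier
alone (gk2-p4) — the crux modulo PRINT, the `2`-converse and multi-genus `2`-primitivity -/

/-- **THE CRUX `GenusPrimitiveSupplyAtTwo` BY NAME, MODULO PRINT ∧ (CONV₂) ∧ (U).** PRINT inputs: Modularity `exists_isNewformOf`
(BCDT 2001), the `2`-parity theorem `p_parity · 2` (Dokchitser–Dokchitser 2010 ∕ Monsky), the Cassels–Tate pairing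
`exists_casselsTate_pairing` (Cassels 1962), the Mazur–Rubin lowering step `hMR` (Mazur–Rubin 2010 Prop. 5.2 in proof form over
`ℚ`, spelled out as by gk2-p5's `minimalSelmerTwinSupply_of_lowering`), and the Gross–Zagier formula `gross_zagier` (gk2-p4's
`stub_heegnerNonTorsionAtTwo_of_grossZagier` discharged the modularity binder of stub B). The two NON-print hypotheses are the
line's open kernels: (CONV₂) the rank-one `2`-converse for non-CM curves (crux 19220 of route `TwoAdicConverse`), and (U) «on
the habitat some multi-genus Heegner trace `Tr_{K[n]/K(√ℓ₁*,…,√ℓ_r*)} y(n)` is not `2`-divisible in `E(K[n])`» (Birch's lemma at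
`2` for full-`2`-image curves ∕ Kolyvagin's conjecture mod `2`; in the binder frame of stub C). CONDITIONAL; crux 22136 is OPEN
exactly at (CONV₂) ∧ (U). BSD is not proved by any of this. [cite: MazurRubin2010, Prop. 5.2 (proof) with Lemma 3.6]
[cite: GrossZagier1986, Thm. I.6.3] [cite: DokchitserDokchitserAnnals2010, Thm. 1.4] [cite: GrossLMS1991, §3 (3.5), §4 (4.1)] -/
theorem genusPrimitiveSupplyAtTwo_of_twoConverse_of_multiGenus (hmod : exists_isNewformOf)
    (hpar : ∀ V : WeierstrassCurve ℚ, p_parity V 2) (hCT : exists_casselsTate_pairing (K := ℚ))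
    (hMR : ∀ (V : WeierstrassCurve ℚ) [V.IsElliptic], Nat.card (V.toAffine.Point[((2 : ℕ) : ℤ)]) = 1 →
      ∀ s : ℕ, Nat.card (V.selmerGroup 2) = 2 ^ s → 1 < s → ∀ m : ℕ, m ≠ 0 →
        ∃ p : ℕ, p.Prime ∧ (p : ℤ) ≡ 1 [ZMOD (m : ℤ)] ∧
          Nat.card ((V.quadraticTwist (p : ℚ)).selmerGroup 2) = 2 ^ (s - 2))
    (hGZ : ∀ (W : WeierstrassCurve ℚ) [NeZero (W.conductorNorm ℤ)] (K : Type) [Field K] [NumberField K],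
      gross_zagier (W.conductorNorm ℤ) W K)
    (hconv : ∀ (V : WeierstrassCurve ℚ) [V.IsElliptic] [V.IsGloballyMinimal],
      ¬ V.HasCM → V.selmerCorank 2 = 1 → V.analyticRank = 1)
    (hU : ∀ (W : WeierstrassCurve ℚ) [W.IsElliptic] [W.IsGloballyMinimal] [NeZero (W.conductorNorm ℤ)],
      ¬ W.HasCM → W.analyticRank = 0 → (∀ n : ℕ, 0 < n → W.HasSurjectiveModNGaloisRep ((2 : ℤ) ^ n)) →
      Odd W.tamagawaProduct →
      ∀ (K : Type) [Field K] [NumberField K],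
      IsImaginaryQuadratic K → Odd (NumberField.discr K) → NumberField.discr K ≠ -3 →
      SatisfiesHeegnerHypothesis (W.conductorNorm ℤ) K →
      ¬ IsSquare ((NumberField.discr K : ℚ) * -|W.Δ|) → ¬ IsSquare ((NumberField.discr K : ℚ) * (-(2 * |W.Δ|))) →
      ∀ (Dt : ModularParametrizationData W (W.conductorNorm ℤ)),
      (∀ z ∈ Dt.L.lattice, ∃ w ∈ periodLattice Dt.f, z = (Dt.c : ℂ) * w) → Odd Dt.c →
      ∀ (β : ℤ) (ι : K →+* ℂ) (d₁ : KolyvaginHeegnerData Dt β ι 1), ¬ IsOfFinAddOrder d₁.derivedPoint →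
      ∀ (Wd : WeierstrassCurve ℚ) [Wd.IsElliptic] [Wd.IsGloballyMinimal],
      (∃ C : WeierstrassCurve.VariableChange ℚ, C • W.quadraticTwist (NumberField.discr K : ℚ) = Wd) →
      Wd.analyticRank = 1 → Nat.card (Wd.selmerGroup 2) = 2 →
      ∃ (n : ℕ) (d : KolyvaginHeegnerData Dt β ι n) (θ : ℕ → ringClassField K ι n)
        (T : Finset (ringClassField K ι n ≃ₐ[ℚ] ringClassField K ι n)), Squarefree n ∧
        (∀ ℓ ∈ n.primeFactors, Zhang2014.IsKolyvaginPrime (W.conductorNorm ℤ) W K 2 ℓ) ∧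
        (∀ ℓ ∈ n.primeFactors, θ ℓ ^ 2 = algebraMap ℚ (ringClassField K ι n) ((-1 : ℚ) ^ (ℓ / 2) * ℓ)) ∧
        (∀ g, g ∈ T ↔ g ∈ ringClassGal ι n ∧ ∀ ℓ ∈ n.primeFactors, g (θ ℓ) = θ ℓ) ∧
        ¬ ∃ Q : (W.baseChange (ringClassField K ι n)).toAffine.Point, (2 : ℤ) • Q =
          ∑ g ∈ T, pointGalHom W (ringClassField K ι n) g d.y) :
    Summit.BirchSwinnertonDyer.BirchSwinnertonDyer.Theses.GenusKolyvaginAtTwo.GenusPrimitiveSupplyAtTwo := by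
  intro W _ _ _ hcm hr0 hρ hT hopt
  -- A = MR-lowering SUPPLY + CONV₂
  obtain ⟨K, iF, iN, hIQ, hodd, h3, hHe, hsq1, hsq2, Wd, iE, iM, hWd, hrd, hSel⟩ :=
    stub_minimalTwinSupplyAtTwo_of_lowering_of_twoConverse hmod hpar hCT hMR hconv W hcm hr0 hρ
  obtain ⟨Dt, hoptDt, hc⟩ := hopt
  obtain ⟨β, hβ⟩ : ∃ β : ℤ, (4 * (W.conductorNorm ℤ : ℕ) : ℤ) ∣ β ^ 2 - NumberField.discr K :=
    Literature.NumberTheory.QuadraticFields.Quadratic.exists_dvd_sq_sub_discr_of_ncard_primesOver hIQ.1 (NeZero.ne _) hHe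
  obtain ⟨ι⟩ : Nonempty (K →+* ℂ) := inferInstance
  obtain ⟨d₁⟩ := exists_kolyvaginHeegnerData_one
    (phi_heegnerTau_mem_singularModuliField_holds (W.conductorNorm ℤ) W K) hIQ Dt β ι hβ
  have hd : (NumberField.discr K : ℚ) ≠ 0 := by exact_mod_cast NumberField.discr_ne_zero K
  haveI := W.isElliptic_quadraticTwist hd
  have hcmd : ¬ Wd.HasCM := twin_not_hasCM W hcm hd Wd hWd
  have hrtw : (W.quadraticTwist (NumberField.discr K : ℚ)).analyticRank = 1 := by
    obtain ⟨C, hC⟩ := hWd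
    rw [← analyticRank_smul (W.quadraticTwist (NumberField.discr K : ℚ)) C, hC]
    exact hrd
  -- B = Gross–Zagier alone
  have hy : ¬ IsOfFinAddOrder d₁.derivedPoint := stub_heegnerNonTorsionAtTwo_of_grossZagier hGZ W K hIQ hHe hr0 hrtw Dt β ι d₁
  obtain ⟨M₀, hdiv, hndiv⟩ := exists_exactTwoDivisibility_of_not_isOfFinAddOrder W hIQ Dt β ι d₁ hy
  -- C = U through the intrinsic dictionary
  obtain ⟨n, d, hn, hKoly, hPn⟩ := exists_derivedPoint_not_two_dvd_of_multiGenusTrace hIQ hodd h3 hHe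
    (hU W hcm hr0 hρ hT K hIQ hodd h3 hHe hsq1 hsq2 Dt hoptDt hc β ι d₁ hy Wd hWd hrd hSel)
  exact ⟨K, iF, iN, hIQ, hodd, h3, hHe, hsq1, hsq2, Dt, β, ι, d₁, hoptDt, hc, hy, M₀, hdiv, hndiv, n, d, hn, hKoly, hPn,
    Wd, iE, iM, hWd, hcmd, hrd, hSel⟩

/-! ### §3 (APPEND 2, same seat) With gk2-p5's typing of Mazur–Rubin Prop. 5.2 as the named fact `MazurRubin2010.prop52_rat`
(p591647, p592578): every print input BY NAME — the crux modulo five named facts, the `2`-converse and multi-genus `2`-primitivity -/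

/-- **THE CRUX `GenusPrimitiveSupplyAtTwo` BY NAME, MODULO FIVE NAMED PRINT FACTS ∧ (CONV₂) ∧ (U).** The named facts:
`exists_isNewformOf` (BCDT 2001), `p_parity · 2` (Dokchitser–Dokchitser 2010), `exists_casselsTate_pairing` (Cassels 1962),
`MazurRubin2010.prop52_rat` (Mazur–Rubin 2010 Prop. 5.2 over `ℚ`, proof form), `gross_zagier` (Gross–Zagier 1986 Thm. I.6.3).
The two remaining binders are the line's open kernels (CONV₂) — the rank-one `2`-converse for non-CM curves, crux 19220 of route
`TwoAdicConverse` widened off its reduction clause — and (U) — multi-genus `2`-primitivity on the habitat, in the frame of stub C.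
This is `genusPrimitiveSupplyAtTwo_of_twoConverse_of_multiGenus` with `hMR := prop52_rat`. CONDITIONAL; crux 22136 is OPEN exactly
at (CONV₂) ∧ (U). BSD is not proved by any of this. [cite: MazurRubin2010, Prop. 5.2 (proof) with Lemma 3.6]
[cite: GrossZagier1986, Thm. I.6.3] [cite: DokchitserDokchitserAnnals2010, Thm. 1.4] [cite: GrossLMS1991, §3 (3.5), §4 (4.1)] -/
theorem genusPrimitiveSupplyAtTwo_of_namedFacts_of_twoConverse_of_multiGenus (hmod : exists_isNewformOf)
    (hpar : ∀ V : WeierstrassCurve ℚ, p_parity V 2) (hCT : exists_casselsTate_pairing (K := ℚ))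
    (hMR : Literature.NumberTheory.EllipticCurves.MazurRubin2010.prop52_rat)
    (hGZ : ∀ (W : WeierstrassCurve ℚ) [NeZero (W.conductorNorm ℤ)] (K : Type) [Field K] [NumberField K],
      gross_zagier (W.conductorNorm ℤ) W K)
    (hconv : ∀ (V : WeierstrassCurve ℚ) [V.IsElliptic] [V.IsGloballyMinimal],
      ¬ V.HasCM → V.selmerCorank 2 = 1 → V.analyticRank = 1)
    (hU : ∀ (W : WeierstrassCurve ℚ) [W.IsElliptic] [W.IsGloballyMinimal] [NeZero (W.conductorNorm ℤ)],
      ¬ W.HasCM → W.analyticRank = 0 → (∀ n : ℕ, 0 < n → W.HasSurjectiveModNGaloisRep ((2 : ℤ) ^ n)) →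
      Odd W.tamagawaProduct →
      ∀ (K : Type) [Field K] [NumberField K],
      IsImaginaryQuadratic K → Odd (NumberField.discr K) → NumberField.discr K ≠ -3 →
      SatisfiesHeegnerHypothesis (W.conductorNorm ℤ) K →
      ¬ IsSquare ((NumberField.discr K : ℚ) * -|W.Δ|) → ¬ IsSquare ((NumberField.discr K : ℚ) * (-(2 * |W.Δ|))) →
      ∀ (Dt : ModularParametrizationData W (W.conductorNorm ℤ)),
      (∀ z ∈ Dt.L.lattice, ∃ w ∈ periodLattice Dt.f, z = (Dt.c : ℂ) * w) → Odd Dt.c →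
      ∀ (β : ℤ) (ι : K →+* ℂ) (d₁ : KolyvaginHeegnerData Dt β ι 1), ¬ IsOfFinAddOrder d₁.derivedPoint →
      ∀ (Wd : WeierstrassCurve ℚ) [Wd.IsElliptic] [Wd.IsGloballyMinimal],
      (∃ C : WeierstrassCurve.VariableChange ℚ, C • W.quadraticTwist (NumberField.discr K : ℚ) = Wd) →
      Wd.analyticRank = 1 → Nat.card (Wd.selmerGroup 2) = 2 →
      ∃ (n : ℕ) (d : KolyvaginHeegnerData Dt β ι n) (θ : ℕ → ringClassField K ι n)
        (T : Finset (ringClassField K ι n ≃ₐ[ℚ] ringClassField K ι n)), Squarefree n ∧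
        (∀ ℓ ∈ n.primeFactors, Zhang2014.IsKolyvaginPrime (W.conductorNorm ℤ) W K 2 ℓ) ∧
        (∀ ℓ ∈ n.primeFactors, θ ℓ ^ 2 = algebraMap ℚ (ringClassField K ι n) ((-1 : ℚ) ^ (ℓ / 2) * ℓ)) ∧
        (∀ g, g ∈ T ↔ g ∈ ringClassGal ι n ∧ ∀ ℓ ∈ n.primeFactors, g (θ ℓ) = θ ℓ) ∧
        ¬ ∃ Q : (W.baseChange (ringClassField K ι n)).toAffine.Point, (2 : ℤ) • Q =
          ∑ g ∈ T, pointGalHom W (ringClassField K ι n) g d.y) :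
    Summit.BirchSwinnertonDyer.BirchSwinnertonDyer.Theses.GenusKolyvaginAtTwo.GenusPrimitiveSupplyAtTwo :=
  genusPrimitiveSupplyAtTwo_of_twoConverse_of_multiGenus hmod hpar hCT hMR hGZ hconv hU

end Summit.BirchSwinnertonDyer.BirchSwinnertonDyer.Theorems.GenusKoly

end
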